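import Summits.CriticalPhenomena.PercolationContinuityZ3.Theorems.PercNonProliferationSubpolynomialBlockingStubSixSlab
import Literature.Probability.Percolation.FiniteClusterTailZ2
import Literature.Probability.Percolation.SiteConnectionTools
import HarnessLib

/-!
# Crux `PercNonProliferation.SubpolynomialBlocking` (stmt-CriticalPhenomena-4446), line `root-trick-wall-patch` — stub `stub_shieldCover`

Helper file for the crux skeleton `Cruxes/SubpolynomialBlocking/Lines/root_trick_wall_patch.lean`
(lead prover-line-stmt-CriticalPhenomena-4446-1). Proves exactly the registered stub signature
`stub_shieldCover`; lands with `--supports stmt-CriticalPhenomena-4446`.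

## The statement (ROOT TRICK: covering + first exit; deterministic)

Let `r ≥ 1` be the patch scale and `n` the seed scale with `4 r < n` and `n + ⌊n/2⌋ < 10 r`.
Write `patch r = {0} × [0, r)²`, `hsBall r = [0, 4r] × [-4r, 5r-1]²` (the order interval
`Set.Icc ![0, -4r, -4r] ![4r, 5r-1, 5r-1]` of `Site 3 = Fin 3 → ℤ`), `farFace r` = the points of
`hsBall r` with `x₀ = 4r` or a lateral coordinate equal to `-4r` or `5r-1`, and for a cell
`c : Fin 10 × Fin 10` let `τ_c = zdShiftIso (0, c₁ r, c₂ r)` (`τ_c z = z + (0, c₁ r, c₂ r)`). The cell `c`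
is SHIELDED in `ω` if there is no open path inside `τ_c '' hsBall r` from `τ_c '' patch r` to
`τ_c '' farFace r`. CLAIM: if `ω ⊆ E(ℤ³)` and all `100` cells are shielded, then the seed box
`B = [0, n] × [0, n + ⌊n/2⌋]²` is sealed across direction `0`: there is no open path inside `B` from
`{x₀ = 0}` to `{x₀ = n}`.

## The argument

Suppose an open path inside `B` joins `x` (`x₀ = 0`) to `y` (`y₀ = n`); by
`exists_walk_of_mem_openConnIn` it is a lattice walk `P` inside `B` with open edges.
* COVERING (`StubShieldCover.exists_fin_ten`): `0 ≤ x₁, x₂ ≤ n + ⌊n/2⌋ < 10 r`, so with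
  `c = (⌊x₁/r⌋, ⌊x₂/r⌋) : Fin 10 × Fin 10` the point `x - (0, c₁ r, c₂ r)` lies in `patch r`, whence
  `x ∈ τ_c '' patch r ⊆ τ_c '' hsBall r`.
* FIRST EXIT (`exists_prefix_exit_edge`): `y₀ = n > 4 r`, so `y ∉ τ_c '' hsBall r`; the maximal
  initial segment `P'` of `P` inside `τ_c '' hsBall r` ends at `f ∈ τ_c '' hsBall r` adjacent to a
  vertex `g ∉ τ_c '' hsBall r` of `P` (so `g ∈ B`, `g₀ ≥ 0`). Neighbours differ by at most `1` in
  each coordinate (`DCT16.abs_sub_le_one_of_adj`), so the constraint violated by `g` forces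
  `f₀ = 4r` or `f₁ - c₁ r ∈ {-4r, 5r-1}` or `f₂ - c₂ r ∈ {-4r, 5r-1}`: `f ∈ τ_c '' farFace r`.
* `P'` is a walk inside `τ_c '' hsBall r` with open edges, so `ω ∈ openConnIn (τ_c '' hsBall r) x f`
  (`mem_openConnIn_of_walk`), i.e. `ω` crosses cell `c` — contradicting its shield.

No new definitions; all sets are written exactly as in the registered signature.
-/

noncomputable section

namespace Summit.CriticalPhenomena.PercolationContinuityZ3.Theorems.SubpolynomialBlocking

open MeasureTheory Filter Topology
open Literature.Probability.Percolation Literature.Probability.LatticeModels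

namespace StubShieldCover

/-- Membership in a translate: `z ∈ τ_v '' S ↔ z - v ∈ S` (`τ_v z = z + v`). -/
theorem mem_image_zdShiftIso_iff {d : ℕ} (v z : Site d) (S : Set (Site d)) :
    z ∈ (zdShiftIso v) '' S ↔ z - v ∈ S := by
  constructor
  · rintro ⟨w, hw, rfl⟩
    simpa only [zdShiftIso_apply, add_sub_cancel_right] using hw
  · intro h
    exact ⟨z - v, h, by simp only [zdShiftIso_apply, sub_add_cancel]⟩

/-- Coordinates of `z - (0, a, b)`. -/
theorem sub_vec_apply (z : Site 3) (a b : ℤ) :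
    (z - ![0, a, b]) 0 = z 0 ∧ (z - ![0, a, b]) 1 = z 1 - a ∧ (z - ![0, a, b]) 2 = z 2 - b := by
  simp

/-- Membership in the half-space ball `hsBall r = Set.Icc ![0, -4r, -4r] ![4r, 5r-1, 5r-1]`,
coordinatewise. -/
theorem mem_hsBall_iff {r : ℕ} {w : Site 3} :
    w ∈ Set.Icc (![0, -(4 * (r : ℤ)), -(4 * (r : ℤ))] : Site 3)
        ![4 * (r : ℤ), 5 * (r : ℤ) - 1, 5 * (r : ℤ) - 1] ↔
      (0 ≤ w 0 ∧ -(4 * (r : ℤ)) ≤ w 1 ∧ -(4 * (r : ℤ)) ≤ w 2) ∧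
        (w 0 ≤ 4 * (r : ℤ) ∧ w 1 ≤ 5 * (r : ℤ) - 1 ∧ w 2 ≤ 5 * (r : ℤ) - 1) := by
  simp only [Set.mem_Icc, Pi.le_def, Fin.forall_fin_succ, IsEmpty.forall_iff, and_true,
    Matrix.cons_val_zero, Matrix.cons_val_succ, Fin.succ_zero_eq_one, Fin.succ_one_eq_two]

/-- Membership in the translated half-space ball `τ_{(0,a,b)} '' hsBall r`, coordinatewise. -/
theorem mem_image_hsBall_iff {r : ℕ} (a b : ℤ) {z : Site 3} :
    z ∈ (zdShiftIso (![0, a, b] : Site 3)) ''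
        Set.Icc (![0, -(4 * (r : ℤ)), -(4 * (r : ℤ))] : Site 3)
          ![4 * (r : ℤ), 5 * (r : ℤ) - 1, 5 * (r : ℤ) - 1] ↔
      (0 ≤ z 0 ∧ -(4 * (r : ℤ)) ≤ z 1 - a ∧ -(4 * (r : ℤ)) ≤ z 2 - b) ∧
        (z 0 ≤ 4 * (r : ℤ) ∧ z 1 - a ≤ 5 * (r : ℤ) - 1 ∧ z 2 - b ≤ 5 * (r : ℤ) - 1) := by
  obtain ⟨h0, h1, h2⟩ := sub_vec_apply z a b
  rw [mem_image_zdShiftIso_iff, mem_hsBall_iff, h0, h1, h2]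

/-- Membership in the seed box `Set.Icc 0 ![n, n + ⌊n/2⌋, n + ⌊n/2⌋]`, coordinatewise. -/
theorem mem_seedBox_iff {n : ℕ} {w : Site 3} :
    w ∈ Set.Icc (0 : Site 3) ![(n : ℤ), (n : ℤ) + (n / 2 : ℕ), (n : ℤ) + (n / 2 : ℕ)] ↔
      (0 ≤ w 0 ∧ 0 ≤ w 1 ∧ 0 ≤ w 2) ∧
        (w 0 ≤ (n : ℤ) ∧ w 1 ≤ (n : ℤ) + (n / 2 : ℕ) ∧ w 2 ≤ (n : ℤ) + (n / 2 : ℕ)) := by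
  simp only [Set.mem_Icc, Pi.le_def, Fin.forall_fin_succ, IsEmpty.forall_iff, and_true,
    Matrix.cons_val_zero, Matrix.cons_val_succ, Fin.succ_zero_eq_one, Fin.succ_one_eq_two,
    Pi.zero_apply]

/-- **Covering**: every integer `a ∈ [0, 10 r)` lies in one of the ten windows `[q r, (q+1) r)`,
`q < 10` (namely `q = ⌊a / r⌋`). -/
theorem exists_fin_ten {r : ℕ} (hr : 1 ≤ r) {a : ℤ} (h0 : 0 ≤ a) (h10 : a < 10 * (r : ℤ)) :
    ∃ q : Fin 10, 0 ≤ a - ((q : ℕ) : ℤ) * (r : ℤ) ∧ a - ((q : ℕ) : ℤ) * (r : ℤ) < (r : ℤ) := by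
  lift a to ℕ using h0
  have ha : a < 10 * r := by exact_mod_cast h10
  have hr0 : 0 < r := hr
  refine ⟨⟨a / r, (Nat.div_lt_iff_lt_mul hr0).2 ha⟩, ?_, ?_⟩
  · have h1 : ((a / r : ℕ) : ℤ) * (r : ℤ) ≤ (a : ℤ) := by exact_mod_cast Nat.div_mul_le_self a r
    show (0 : ℤ) ≤ (a : ℤ) - ((a / r : ℕ) : ℤ) * (r : ℤ)
    linarith
  · have h2 : (a : ℤ) < ((a / r : ℕ) : ℤ) * (r : ℤ) + (r : ℤ) := by
      exact_mod_cast Nat.lt_div_mul_add hr0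
    show (a : ℤ) - ((a / r : ℕ) : ℤ) * (r : ℤ) < (r : ℤ)
    linarith

end StubShieldCover

open StubShieldCover in
/-- **Registered stub `stub_shieldCover`** (line `root-trick-wall-patch`, crux `SubpolynomialBlocking`):
the ROOT TRICK. With `r ≥ 1` the patch scale, `4 r < n`, `n + ⌊n/2⌋ < 10 r`, and the `100` cells
`c : Fin 10 × Fin 10` translated by `v_c = (0, c₁ r, c₂ r)`: if `ω ⊆ E(ℤ³)` and no cell has an
open path inside `v_c + [0,4r] × [-4r,5r-1]²` from its patch `v_c + {0} × [0,r)²` to its far face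
(depth `4r` or extreme lateral coordinate), then there is no open path inside the seed box
`[0,n] × [0, n + ⌊n/2⌋]²` from `{x₀ = 0}` to `{x₀ = n}`. Proof: covering of the bottom face by the
`100` patches + first exit of the open lattice walk from the starting cell's half-space ball, which
happens through the far face because the walk stays in `{x₀ ≥ 0}` and ends at depth `n > 4r`. -/
theorem stub_shieldCover :
    ∀ n r : ℕ, 1 ≤ r → 4 * r < n → n + n / 2 < 10 * r →
      ∀ ω : BondConfig (Site 3), ω ⊆ (zdGraph 3).edgeSet →
        (∀ c : Fin 10 × Fin 10, ω ∈ (openCrossing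
            ((zdShiftIso (![0, ((c.1 : ℕ) : ℤ) * (r : ℤ), ((c.2 : ℕ) : ℤ) * (r : ℤ)] : Site 3)) ''
              Set.Icc (![0, -(4 * (r : ℤ)), -(4 * (r : ℤ))] : Site 3) ![4 * (r : ℤ), 5 * (r : ℤ) - 1, 5 * (r : ℤ) - 1])
            ((zdShiftIso (![0, ((c.1 : ℕ) : ℤ) * (r : ℤ), ((c.2 : ℕ) : ℤ) * (r : ℤ)] : Site 3)) ''
              {x : Site 3 | x 0 = 0 ∧ 0 ≤ x 1 ∧ x 1 < (r : ℤ) ∧ 0 ≤ x 2 ∧ x 2 < (r : ℤ)})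
            ((zdShiftIso (![0, ((c.1 : ℕ) : ℤ) * (r : ℤ), ((c.2 : ℕ) : ℤ) * (r : ℤ)] : Site 3)) ''
              {y : Site 3 | y ∈ Set.Icc (![0, -(4 * (r : ℤ)), -(4 * (r : ℤ))] : Site 3)
                  ![4 * (r : ℤ), 5 * (r : ℤ) - 1, 5 * (r : ℤ) - 1] ∧
                (y 0 = 4 * (r : ℤ) ∨ y 1 = -(4 * (r : ℤ)) ∨ y 1 = 5 * (r : ℤ) - 1 ∨
                  y 2 = -(4 * (r : ℤ)) ∨ y 2 = 5 * (r : ℤ) - 1)}))ᶜ) →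
        ω ∈ (openCrossing (Set.Icc (0 : Site 3) ![(n : ℤ), (n : ℤ) + (n / 2 : ℕ), (n : ℤ) + (n / 2 : ℕ)])
            {x | x ∈ Set.Icc (0 : Site 3) ![(n : ℤ), (n : ℤ) + (n / 2 : ℕ), (n : ℤ) + (n / 2 : ℕ)] ∧ x 0 = 0}
            {y | y ∈ Set.Icc (0 : Site 3) ![(n : ℤ), (n : ℤ) + (n / 2 : ℕ), (n : ℤ) + (n / 2 : ℕ)] ∧
              y 0 = (n : ℤ)})ᶜ := by
  intro n r hr h4 h10 ω hω hshield
  rw [Set.mem_compl_iff, mem_openCrossing_iff]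
  rintro ⟨x, ⟨hxB, hx0⟩, y, ⟨-, hyn⟩, hxy⟩
  obtain ⟨P, hPS, hPω⟩ := exists_walk_of_mem_openConnIn hω hxy
  rw [mem_seedBox_iff] at hxB
  obtain ⟨⟨-, hx1, hx2⟩, -, hx1', hx2'⟩ := hxB
  -- (a) COVERING: the cell of `x`.
  obtain ⟨q₁, hq₁, hq₁'⟩ := exists_fin_ten hr hx1 (by omega)
  obtain ⟨q₂, hq₂, hq₂'⟩ := exists_fin_ten hr hx2 (by omega)
  refine hshield (q₁, q₂) ?_
  dsimp only
  set a : ℤ := ((q₁ : ℕ) : ℤ) * (r : ℤ) with ha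
  set b : ℤ := ((q₂ : ℕ) : ℤ) * (r : ℤ) with hb
  have hxS : x ∈ (zdShiftIso (![0, a, b] : Site 3)) ''
      Set.Icc (![0, -(4 * (r : ℤ)), -(4 * (r : ℤ))] : Site 3)
        ![4 * (r : ℤ), 5 * (r : ℤ) - 1, 5 * (r : ℤ) - 1] := by
    rw [mem_image_hsBall_iff]
    omega
  have hyS : y ∉ (zdShiftIso (![0, a, b] : Site 3)) ''
      Set.Icc (![0, -(4 * (r : ℤ)), -(4 * (r : ℤ))] : Site 3)
        ![4 * (r : ℤ), 5 * (r : ℤ) - 1, 5 * (r : ℤ) - 1] := by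
    rw [mem_image_hsBall_iff]
    omega
  -- (b) FIRST EXIT from the cell's half-space ball.
  obtain ⟨f, g, hfS, hgS, hadj, -, hgP, P', -, hP'e, hP'S⟩ := exists_prefix_exit_edge _ P hxS hyS
  have hgB := hPS g hgP
  rw [mem_seedBox_iff] at hgB
  have hfS' := hfS
  rw [mem_image_hsBall_iff] at hfS' hgS
  have hd0 := DCT16.abs_sub_le_one_of_adj hadj 0
  have hd1 := DCT16.abs_sub_le_one_of_adj hadj 1
  have hd2 := DCT16.abs_sub_le_one_of_adj hadj 2
  rw [abs_le] at hd0 hd1 hd2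
  -- (c) the initial segment is an open path of the cell from its patch to its far face.
  refine ⟨x, ?_, f, ?_, mem_openConnIn_of_walk P' hP'S fun e he => hPω e (hP'e e he)⟩
  · rw [mem_image_zdShiftIso_iff]
    obtain ⟨h0, h1, h2⟩ := sub_vec_apply x a b
    refine ⟨?_, ?_, ?_, ?_, ?_⟩
    · rw [h0]; exact hx0
    · rw [h1]; exact hq₁
    · rw [h1]; exact hq₁'
    · rw [h2]; exact hq₂
    · rw [h2]; exact hq₂'
  · rw [mem_image_zdShiftIso_iff]
    refine ⟨(mem_image_zdShiftIso_iff _ _ _).1 hfS, ?_⟩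
    obtain ⟨h0, h1, h2⟩ := sub_vec_apply f a b
    rw [h0, h1, h2]
    omega

end Summit.CriticalPhenomena.PercolationContinuityZ3.Theorems.SubpolynomialBlocking

end
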